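import Mathlib.Analysis.Calculus.FDeriv.Mul
import Mathlib.Analysis.Calculus.FDeriv.Add
import Mathlib.Analysis.Calculus.FDeriv.Pi
import Mathlib.Analysis.Calculus.InverseFunctionTheorem.ContDiff
import Mathlib.LinearAlgebra.FiniteDimensional.Lemmas
import Mathlib.LinearAlgebra.Dimension.OrzechProperty
import Literature.AlgebraicGeometry.RealAlgebraic.RealPointsManifold
import Literature.AlgebraicGeometry.HodgeTheory.GAGADimensionAlgebra
import Literature.AlgebraicGeometry.Motives.AlgPointsProperProofs
import Literature.AlgebraicGeometry.Motives.VarietiesDimensionProofs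
import Mathlib.RingTheory.RingHom.StandardSmooth
import HarnessLib

/-!
# Differentials of regular functions at a real point; local coordinates; centred analytic charts

Let `X` be an `ℝ`-scheme, `X(ℝ)` its real points with the strong topology
(`Literature.AlgebraicGeometry.Motives.AlgPoints`) and `e` an analytic algebraic chart of `X(ℝ)` at
`Q₀` (`RealAlgebraic/RealAlgebraicCharts`, `RealAlgebraic/RealPointsManifold`: coordinates are
regular functions, regular functions are real-analytic in the chart). For `s ∈ Γ(X, U)`, `U ∋ Q₀`
affine, write `ds := fderiv ℝ (s ∘ e⁻¹) (e Q₀)` and `𝔪 = ker (evaluation at Q₀) ⊆ Γ(X, U)`. This is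
the real counterpart of the tree's complex file `HodgeTheory/GAGADimensionCharts` (Serre's «point
simple» argument, GAGA §2 n°6 Cor. 2), with the same proofs:

* `fderiv_chart_mul`, `_add`, `_smul`, `_sum`, `_scalarRingHom`, `fderiv_chart_eq_zero_of_mem_sq` —
  `d` is an `ℝ`-linear point derivation at `Q₀` killing `𝔪²`; `fderiv_chart_coord` — `dxᵢ = prᵢ`
  for the chart coordinates;
* `fderiv_chart_mem_span`, `linearIndependent_fderiv_chart` — if `t₁, …, tₙ` span `𝔪` modulo `𝔪²`
  then the `dtᵢ` span the cotangent space `(ℝⁿ)^*` and are linearly independent;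
* `exists_localCoordinates_le` — for `X` smooth of relative dimension `n` over `ℝ`, every real point
  has, inside any prescribed open, an affine neighbourhood `U` and `t₁, …, tₙ ∈ 𝔪 ⊆ Γ(X, U)` spanning
  `𝔪` modulo `𝔪²` (the local ring at a real point of a smooth `n`-dimensional `ℝ`-scheme is regular of
  dimension `n`; Görtz–Wedhorn I Lemma 6.26; the tree's `GAGADimension.exists_sub_sum_smul_mem_sq`);
* `exists_centredChart` — **local coordinates are analytic coordinates**: for the `C^ω` manifold
  structure of `RealPointsManifold.exists_chartedSpace_isManifold` and such `t`, there is a chart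
  `φ` of the maximal `C^ω` atlas at `Q₀`, inside any prescribed neighbourhood, with `φ(Q₀) = 0`,
  `φ(Q) = (t₁(Q), …, tₙ(Q))` on its source, in which all regular functions are real-analytic
  (inverse function theorem: `(dtᵢ)` is invertible). (Serre, GAGA §2 n°6 Cor. 2: a regular system
  of parameters of `𝒪_x` is a system of local analytic coordinates; Bochnak–Coste–Roy Prop. 3.3.11
  and §3.4 for real points.)

Everything is proved; no named facts.

## References

* J.-P. Serre, *Géométrie algébrique et géométrie analytique*, Ann. Inst. Fourier **6** (1956),
  §1 n°4, §2 n°5 Prop. 2, n°6 Cor. 2. [SerreGAGA1956]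
* J. Bochnak, M. Coste, M.-F. Roy, *Real Algebraic Geometry* (1998), Prop. 3.3.11, §3.4.
  [BochnakCosteRoy1998]
* U. Görtz, T. Wedhorn, *Algebraic Geometry I* (2nd ed. 2020), Lemma 6.26. [GortzWedhorn2020]
-/

noncomputable section

open scoped Manifold ContDiff Topology
open CategoryTheory AlgebraicGeometry Filter Set
open Literature.AlgebraicGeometry.Motives
open Literature.AlgebraicGeometry.Motives.AlgPoints (evalOrZero evalOrZero_of_mem evalOrZero_of_not_mem)

namespace Literature.AlgebraicGeometry.RealAlgebraic

namespace RealPoints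

variable {X : SchemeOver ℝ} {n : ℕ}

/-! ### Pointwise identities for `evalOrZero` -/

section Pointwise

/-- `evalOrZero U` is multiplicative (on `U(ℝ)` it is the evaluation ring homomorphism, off `U(ℝ)`
both sides vanish). [folklore] -/
theorem evalOrZero_mul (U : X.left.Opens) (s t : Γ(X.left, U)) :
    (evalOrZero U (s * t) : AlgPoints X ℝ → ℝ) = evalOrZero U s * evalOrZero U t := by
  funext Q
  by_cases hQ : Q.pt ∈ U
  · simp only [Pi.mul_apply, evalOrZero_of_mem _ hQ, ← AlgPoints.evalRingHom_apply, map_mul]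
  · simp only [Pi.mul_apply, evalOrZero_of_not_mem _ hQ, mul_zero]

/-- `evalOrZero U` is additive. [folklore] -/
theorem evalOrZero_add (U : X.left.Opens) (s t : Γ(X.left, U)) :
    (evalOrZero U (s + t) : AlgPoints X ℝ → ℝ) = evalOrZero U s + evalOrZero U t := by
  funext Q
  by_cases hQ : Q.pt ∈ U
  · simp only [Pi.add_apply, evalOrZero_of_mem _ hQ, ← AlgPoints.evalRingHom_apply, map_add]
  · simp only [Pi.add_apply, evalOrZero_of_not_mem _ hQ, add_zero]

/-- The scalar `c` takes the value `c` at every real point of `U`. [folklore] -/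
theorem evalOrZero_scalarRingHom (U : X.left.Opens) (c : ℝ) {Q : AlgPoints X ℝ}
    (hQ : Q.pt ∈ U) : evalOrZero U (SchemeOver.scalarRingHom X U c) Q = c := by
  rw [evalOrZero_of_mem _ hQ, AlgPoints.eval_scalarRingHom]
  rfl

/-- Evaluation at a real point of `U` is onto `ℝ` (the scalars are hit). [folklore] -/
theorem evalRingHom_surjective {U : X.left.Opens} (Q : AlgPoints X ℝ) (hQ : Q.pt ∈ U) :
    Function.Surjective (Q.evalRingHom U hQ) := fun c =>
  ⟨SchemeOver.scalarRingHom X U c, by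
    rw [AlgPoints.evalRingHom_apply, AlgPoints.eval_scalarRingHom]; rfl⟩

/-- The kernel of evaluation at a real point is a maximal ideal of `Γ(X, U)`. [folklore] -/
theorem isMaximal_ker_evalRingHom {U : X.left.Opens} (Q : AlgPoints X ℝ) (hQ : Q.pt ∈ U) :
    (RingHom.ker (Q.evalRingHom U hQ)).IsMaximal :=
  RingHom.ker_isMaximal_of_surjective _ (evalRingHom_surjective Q hQ)

end Pointwise

/-! ### The differential at a point of a regular function read in an analytic algebraic chart -/

section Chart

variable (e : OpenPartialHomeomorph (AlgPoints X ℝ) (Fin n → ℝ)) {Q₀ : AlgPoints X ℝ}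
  (hQ₀ : Q₀ ∈ e.source)
  (hol : ∀ (U : X.left.affineOpens) (s : Γ(X.left, ↑U)),
    AnalyticOnNhd ℝ (evalOrZero ↑U s ∘ e.symm)
      (e.target ∩ e.symm ⁻¹' {Q | Q.pt ∈ (↑U : X.left.Opens)}))

include hQ₀ in
/-- The chart image of `U(ℝ)`, `e.target ∩ e⁻¹⁻¹(U(ℝ))`, is a neighbourhood of `e Q₀` when
`Q₀ ∈ U(ℝ)`. [folklore] -/
theorem chart_nhds {U : X.left.Opens} (hU : Q₀.pt ∈ U) :
    e.target ∩ e.symm ⁻¹' {Q : AlgPoints X ℝ | Q.pt ∈ U} ∈ 𝓝 (e Q₀) :=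
  (e.isOpen_inter_preimage_symm (AlgPoints.isOpen_setOf_pt_mem U)).mem_nhds
    ⟨e.map_source hQ₀, by
      simp only [Set.mem_preimage, Set.mem_setOf_eq, e.left_inv hQ₀]
      exact hU⟩

include hQ₀ hol in
/-- Regular functions are analytic at `e Q₀` when read in the chart. [folklore] -/
theorem analyticAt_chart (U : X.left.affineOpens) (hU : Q₀.pt ∈ (↑U : X.left.Opens))
    (s : Γ(X.left, ↑U)) : AnalyticAt ℝ (evalOrZero ↑U s ∘ e.symm) (e Q₀) :=
  hol U s _ ⟨e.map_source hQ₀, by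
    simp only [Set.mem_preimage, Set.mem_setOf_eq, e.left_inv hQ₀]; exact hU⟩

include hQ₀ hol in
/-- Regular functions are differentiable at `e Q₀` when read in the chart. [folklore] -/
theorem differentiableAt_chart (U : X.left.affineOpens) (hU : Q₀.pt ∈ (↑U : X.left.Opens))
    (s : Γ(X.left, ↑U)) : DifferentiableAt ℝ (evalOrZero ↑U s ∘ e.symm) (e Q₀) :=
  (analyticAt_chart e hQ₀ hol U hU s).differentiableAt

include hQ₀ in
/-- **Constants have zero differential**: the scalar `c ∈ Γ(X, U)` reads as the constant function
`c` near `e Q₀`. [folklore] -/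
theorem fderiv_chart_scalarRingHom (U : X.left.affineOpens) (hU : Q₀.pt ∈ (↑U : X.left.Opens))
    (c : ℝ) :
    fderiv ℝ (evalOrZero ↑U (SchemeOver.scalarRingHom X ↑U c) ∘ e.symm) (e Q₀) = 0 := by
  have h : evalOrZero ↑U (SchemeOver.scalarRingHom X ↑U c) ∘ e.symm =ᶠ[𝓝 (e Q₀)]
      fun _ => c := by
    filter_upwards [chart_nhds e hQ₀ hU] with w hw
    exact evalOrZero_scalarRingHom _ c hw.2
  rw [h.fderiv_eq, fderiv_const_apply]

include hQ₀ hol in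
/-- **Leibniz rule** for the differential at `e Q₀` of regular functions read in the chart.
[folklore] -/
theorem fderiv_chart_mul (U : X.left.affineOpens) (hU : Q₀.pt ∈ (↑U : X.left.Opens))
    (s t : Γ(X.left, ↑U)) :
    fderiv ℝ (evalOrZero ↑U (s * t) ∘ e.symm) (e Q₀) =
      Q₀.eval ↑U hU s • fderiv ℝ (evalOrZero ↑U t ∘ e.symm) (e Q₀) +
        Q₀.eval ↑U hU t • fderiv ℝ (evalOrZero ↑U s ∘ e.symm) (e Q₀) := by
  have h : evalOrZero ↑U (s * t) ∘ e.symm =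
      fun w => (evalOrZero ↑U s ∘ e.symm) w • (evalOrZero ↑U t ∘ e.symm) w := by
    rw [evalOrZero_mul]
    rfl
  rw [h, fderiv_fun_smul (differentiableAt_chart e hQ₀ hol U hU s)
    (differentiableAt_chart e hQ₀ hol U hU t)]
  have e1 : (evalOrZero ↑U s ∘ e.symm) (e Q₀) = Q₀.eval ↑U hU s := by
    simp [e.left_inv hQ₀, evalOrZero_of_mem _ hU]
  have e2 : (evalOrZero ↑U t ∘ e.symm) (e Q₀) = Q₀.eval ↑U hU t := by
    simp [e.left_inv hQ₀, evalOrZero_of_mem _ hU]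
  rw [e1, e2]
  congr 1
  ext v
  simp [mul_comm]

include hQ₀ hol in
/-- Additivity of the differential at `e Q₀`. [folklore] -/
theorem fderiv_chart_add (U : X.left.affineOpens) (hU : Q₀.pt ∈ (↑U : X.left.Opens))
    (s t : Γ(X.left, ↑U)) :
    fderiv ℝ (evalOrZero ↑U (s + t) ∘ e.symm) (e Q₀) =
      fderiv ℝ (evalOrZero ↑U s ∘ e.symm) (e Q₀) + fderiv ℝ (evalOrZero ↑U t ∘ e.symm) (e Q₀) := by
  have h : evalOrZero ↑U (s + t) ∘ e.symm =
      (evalOrZero ↑U s ∘ e.symm) + (evalOrZero ↑U t ∘ e.symm) := by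
    rw [evalOrZero_add]
    rfl
  rw [h, fderiv_add (differentiableAt_chart e hQ₀ hol U hU s)
    (differentiableAt_chart e hQ₀ hol U hU t)]

include hQ₀ hol in
/-- Homogeneity: `d(c s) = c ds` for a scalar `c`. [folklore] -/
theorem fderiv_chart_smul (U : X.left.affineOpens) (hU : Q₀.pt ∈ (↑U : X.left.Opens))
    (c : ℝ) (s : Γ(X.left, ↑U)) :
    fderiv ℝ (evalOrZero ↑U (SchemeOver.scalarRingHom X ↑U c * s) ∘ e.symm) (e Q₀) =
      c • fderiv ℝ (evalOrZero ↑U s ∘ e.symm) (e Q₀) := by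
  have h : evalOrZero ↑U (SchemeOver.scalarRingHom X ↑U c * s) ∘ e.symm =ᶠ[𝓝 (e Q₀)]
      fun w => c • (evalOrZero ↑U s ∘ e.symm) w := by
    filter_upwards [chart_nhds e hQ₀ hU] with w hw
    simp only [Function.comp_apply, smul_eq_mul, evalOrZero_of_mem _ hw.2,
      ← AlgPoints.evalRingHom_apply, map_mul]
    rw [AlgPoints.evalRingHom_apply, AlgPoints.evalRingHom_apply, AlgPoints.eval_scalarRingHom]
    rfl
  rw [h.fderiv_eq, fderiv_fun_const_smul (differentiableAt_chart e hQ₀ hol U hU s) c]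

include hQ₀ hol in
/-- Finite sums. [folklore] -/
theorem fderiv_chart_sum (U : X.left.affineOpens) (hU : Q₀.pt ∈ (↑U : X.left.Opens))
    {ι : Type*} (I : Finset ι) (s : ι → Γ(X.left, ↑U)) :
    fderiv ℝ (evalOrZero ↑U (∑ i ∈ I, s i) ∘ e.symm) (e Q₀) =
      ∑ i ∈ I, fderiv ℝ (evalOrZero ↑U (s i) ∘ e.symm) (e Q₀) := by
  classical
  induction I using Finset.induction_on with
  | empty =>
    rw [Finset.sum_empty, Finset.sum_empty, ← map_zero (SchemeOver.scalarRingHom X ↑U),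
      fderiv_chart_scalarRingHom e hQ₀ U hU]
  | insert a I ha ih =>
    rw [Finset.sum_insert ha, Finset.sum_insert ha, fderiv_chart_add e hQ₀ hol U hU, ih]

include hQ₀ hol in
/-- **The differential kills `𝔪²`**: products of two regular functions vanishing at `Q₀` have zero
differential at `e Q₀`, hence so does every element of the square of the maximal ideal
`𝔪 = {s | s(Q₀) = 0}`. [folklore] -/
theorem fderiv_chart_eq_zero_of_mem_sq (U : X.left.affineOpens) (hU : Q₀.pt ∈ (↑U : X.left.Opens))
    {a : Γ(X.left, ↑U)} (ha : a ∈ RingHom.ker (Q₀.evalRingHom ↑U hU) ^ 2) :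
    fderiv ℝ (evalOrZero ↑U a ∘ e.symm) (e Q₀) = 0 := by
  rw [pow_two] at ha
  refine Submodule.mul_induction_on ha (fun s hs t ht => ?_) (fun x y hx hy => ?_)
  · rw [RingHom.mem_ker, AlgPoints.evalRingHom_apply] at hs ht
    rw [fderiv_chart_mul e hQ₀ hol U hU, hs, ht]
    ext v
    simp
  · rw [fderiv_chart_add e hQ₀ hol U hU, hx, hy, add_zero]

/-! ### Local coordinates: the differentials of `Γ(X, U)` span the cotangent space -/

/-- A linear form on `ℝᶜ` is determined by its values on the standard basis:
`μ w = ∑ⱼ w j · μ(eⱼ)`. [folklore] -/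
theorem dual_apply_eq_sum {c : ℕ} (μ : (Fin c → ℝ) →ₗ[ℝ] ℝ) (w : Fin c → ℝ) :
    μ w = ∑ j, w j * μ (Pi.single j 1) := by
  conv_lhs => rw [pi_eq_sum_univ' w]
  simp only [map_sum, map_smul, smul_eq_mul]

include hQ₀ hol in
/-- If `t₁, …, tₙ ∈ 𝔪` span `𝔪` modulo `𝔪²` over `ℝ` (`𝔪 = {a | a(Q₀) = 0} ⊂ Γ(X, U)`), then the
differential at `e Q₀` of every `a ∈ Γ(X, U)` is an `ℝ`-combination of the `dtᵢ`. [folklore] -/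
theorem fderiv_chart_mem_span {m : ℕ} (U : X.left.affineOpens) (hU : Q₀.pt ∈ (↑U : X.left.Opens))
    (t : Fin m → Γ(X.left, ↑U))
    (htspan : ∀ a ∈ RingHom.ker (Q₀.evalRingHom ↑U hU), ∃ coef : Fin m → ℝ,
      a - ∑ i, SchemeOver.scalarRingHom X ↑U (coef i) * t i ∈
        RingHom.ker (Q₀.evalRingHom ↑U hU) ^ 2)
    (a : Γ(X.left, ↑U)) :
    fderiv ℝ (evalOrZero ↑U a ∘ e.symm) (e Q₀) ∈
      Submodule.span ℝ (Set.range fun i => fderiv ℝ (evalOrZero ↑U (t i) ∘ e.symm) (e Q₀)) := by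
  set κ := SchemeOver.scalarRingHom X (↑U : X.left.Opens) with hκ
  have ha' : a - κ (Q₀.eval ↑U hU a) ∈ RingHom.ker (Q₀.evalRingHom ↑U hU) := by
    rw [RingHom.mem_ker, map_sub, AlgPoints.evalRingHom_apply, AlgPoints.evalRingHom_apply,
      AlgPoints.eval_scalarRingHom, sub_eq_zero]
    rfl
  obtain ⟨coef, hcoef⟩ := htspan _ ha'
  have h0 := fderiv_chart_eq_zero_of_mem_sq e hQ₀ hol U hU hcoef
  have e1 : a = (a - κ (Q₀.eval ↑U hU a) - ∑ i, κ (coef i) * t i) +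
      (∑ i, κ (coef i) * t i + κ (Q₀.eval ↑U hU a)) := by ring
  rw [e1, fderiv_chart_add e hQ₀ hol U hU, h0, zero_add, fderiv_chart_add e hQ₀ hol U hU,
    fderiv_chart_scalarRingHom e hQ₀ U hU, add_zero, fderiv_chart_sum e hQ₀ hol U hU]
  refine Submodule.sum_mem _ fun i _ => ?_
  rw [fderiv_chart_smul e hQ₀ hol U hU]
  exact Submodule.smul_mem _ _ (Submodule.subset_span ⟨i, rfl⟩)

include hQ₀ in
/-- The coordinates of an algebraic chart are regular functions `xᵢ` whose read-off in the chart
is the `i`-th coordinate function, so `dxᵢ = prᵢ` at `e Q₀`. [folklore] -/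
theorem fderiv_chart_coord (U₁ : X.left.affineOpens) (x : Fin n → Γ(X.left, ↑U₁))
    (hx : ∀ Q ∈ e.source, ∀ i, e Q i = evalOrZero ↑U₁ (x i) Q) (i : Fin n) :
    fderiv ℝ (evalOrZero ↑U₁ (x i) ∘ e.symm) (e Q₀) = ContinuousLinearMap.proj i := by
  have h : evalOrZero ↑U₁ (x i) ∘ e.symm =ᶠ[𝓝 (e Q₀)] fun w => w i := by
    filter_upwards [e.open_target.mem_nhds (e.map_source hQ₀)] with w hw
    simp only [Function.comp_apply]
    rw [← hx _ (e.map_target hw) i, e.right_inv hw]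
  rw [h.fderiv_eq]
  exact (hasFDerivAt_apply i (e Q₀)).fderiv

include hQ₀ hol in
/-- **The differentials of `Γ(X, U)` span the cotangent space.** If `t₁, …, tₘ` span
`𝔪 ⊂ Γ(X, U)` modulo `𝔪²` and `e` has regular coordinates, then every coordinate form `prᵢ` is an
`ℝ`-combination of the `dtⱼ` (each `prᵢ = dxᵢ` is the differential of a fraction `a / uᵏ`,
`a, u ∈ Γ(X, U)`, read on a basic open `D(u) ⊆ U ∩ U₁`). [folklore] -/
theorem top_le_span_fderiv_chart {m : ℕ} (U : X.left.affineOpens)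
    (hU : Q₀.pt ∈ (↑U : X.left.Opens)) (t : Fin m → Γ(X.left, ↑U))
    (htspan : ∀ a ∈ RingHom.ker (Q₀.evalRingHom ↑U hU), ∃ coef : Fin m → ℝ,
      a - ∑ i, SchemeOver.scalarRingHom X ↑U (coef i) * t i ∈
        RingHom.ker (Q₀.evalRingHom ↑U hU) ^ 2)
    (alg : ∃ (U₁ : X.left.affineOpens) (x : Fin n → Γ(X.left, ↑U₁)),
      e.source ⊆ {Q | Q.pt ∈ (↑U₁ : X.left.Opens)} ∧
        ∀ Q ∈ e.source, ∀ i, e Q i = evalOrZero ↑U₁ (x i) Q) :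
    ⊤ ≤ Submodule.span ℝ (Set.range fun i => fderiv ℝ (evalOrZero ↑U (t i) ∘ e.symm) (e Q₀)) := by
  classical
  set V := Submodule.span ℝ (Set.range fun i => fderiv ℝ (evalOrZero ↑U (t i) ∘ e.symm) (e Q₀))
    with hV
  -- every coordinate form lies in `V`
  have hproj : ∀ i, (ContinuousLinearMap.proj i : (Fin n → ℝ) →L[ℝ] ℝ) ∈ V := by
    intro i
    obtain ⟨U₁, x, hsrc, hx⟩ := alg
    have hU₁ : Q₀.pt ∈ (↑U₁ : X.left.Opens) := hsrc hQ₀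
    -- a basic open `D(u) ⊆ U ∩ U₁` around `Q₀`
    obtain ⟨u, hule, hQ₀u⟩ := U.2.exists_basicOpen_le ⟨Q₀.pt, hU₁⟩ hU
    obtain ⟨a, k, hak⟩ := AlgPoints.exists_map_mul_pow_eq_algebraMap U.2 u (x i) hule
    have hu0 : Q₀.eval ↑U hU u ≠ 0 := (AlgPoints.pt_mem_basicOpen_iff Q₀ hU u).1 hQ₀u
    -- pointwise on `D(u)(ℝ)`: `xᵢ(Q) u(Q)ᵏ = a(Q)`
    have hpt : ∀ Q : AlgPoints X ℝ, Q.pt ∈ X.left.basicOpen u →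
        evalOrZero ↑U₁ (x i) Q * evalOrZero ↑U (u ^ k) Q = evalOrZero ↑U a Q := by
      intro Q hQ
      have hQU : Q.pt ∈ (↑U : X.left.Opens) := X.left.basicOpen_le u hQ
      have key := congrArg (Q.evalRingHom (X.left.basicOpen u) hQ) hak
      simp only [map_mul, map_pow, AlgPoints.evalRingHom_apply] at key
      rw [AlgPoints.eval_res Q hule hQ (x i)] at key
      have h1 : Q.eval (X.left.basicOpen u) hQ (algebraMap Γ(X.left, ↑U) _ u) = Q.eval ↑U hQU u :=
        AlgPoints.eval_res Q (X.left.basicOpen_le u) hQ u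
      have h2 : Q.eval (X.left.basicOpen u) hQ (algebraMap Γ(X.left, ↑U) _ a) = Q.eval ↑U hQU a :=
        AlgPoints.eval_res Q (X.left.basicOpen_le u) hQ a
      rw [h1, h2] at key
      rw [evalOrZero_of_mem _ (hule hQ), evalOrZero_of_mem _ hQU, evalOrZero_of_mem _ hQU,
        ← AlgPoints.evalRingHom_apply Q ↑U hQU, map_pow, AlgPoints.evalRingHom_apply]
      exact key
    have hev : evalOrZero ↑U a ∘ e.symm =ᶠ[𝓝 (e Q₀)]
        fun w => (evalOrZero ↑U₁ (x i) ∘ e.symm) w • (evalOrZero ↑U (u ^ k) ∘ e.symm) w := by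
      filter_upwards [chart_nhds e hQ₀ hQ₀u] with w hw
      exact (hpt _ hw.2).symm
    have hdiffx : DifferentiableAt ℝ (evalOrZero ↑U₁ (x i) ∘ e.symm) (e Q₀) :=
      differentiableAt_chart e hQ₀ hol U₁ hU₁ (x i)
    have hdiffu : DifferentiableAt ℝ (evalOrZero ↑U (u ^ k) ∘ e.symm) (e Q₀) :=
      differentiableAt_chart e hQ₀ hol U hU (u ^ k)
    have hda := hev.fderiv_eq (𝕜 := ℝ)
    rw [fderiv_fun_smul hdiffx hdiffu, fderiv_chart_coord e hQ₀ U₁ x hx i] at hda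
    have ex : (evalOrZero ↑U₁ (x i) ∘ e.symm) (e Q₀) = Q₀.eval ↑U₁ hU₁ (x i) := by
      simp [e.left_inv hQ₀, evalOrZero_of_mem _ hU₁]
    have eu : (evalOrZero ↑U (u ^ k) ∘ e.symm) (e Q₀) = Q₀.eval ↑U hU (u ^ k) := by
      simp [e.left_inv hQ₀, evalOrZero_of_mem _ hU]
    have hsr : (ContinuousLinearMap.proj i : (Fin n → ℝ) →L[ℝ] ℝ).smulRight
        (Q₀.eval ↑U hU (u ^ k)) =
        Q₀.eval ↑U hU (u ^ k) • (ContinuousLinearMap.proj i : (Fin n → ℝ) →L[ℝ] ℝ) := by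
      ext v
      simp [mul_comm]
    rw [ex, eu, hsr] at hda
    -- solve for `proj i`
    have huk : Q₀.eval ↑U hU (u ^ k) ≠ 0 := by
      rw [← AlgPoints.evalRingHom_apply, map_pow, AlgPoints.evalRingHom_apply]
      exact pow_ne_zero _ hu0
    have e2 : (ContinuousLinearMap.proj i : (Fin n → ℝ) →L[ℝ] ℝ) =
        (Q₀.eval ↑U hU (u ^ k))⁻¹ • (fderiv ℝ (evalOrZero ↑U a ∘ e.symm) (e Q₀) -
          Q₀.eval ↑U₁ hU₁ (x i) • fderiv ℝ (evalOrZero ↑U (u ^ k) ∘ e.symm) (e Q₀)) := by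
      rw [hda, add_sub_cancel_left, smul_smul, inv_mul_cancel₀ huk, one_smul]
    rw [e2]
    exact Submodule.smul_mem _ _ (Submodule.sub_mem _
      (fderiv_chart_mem_span e hQ₀ hol U hU t htspan a)
      (Submodule.smul_mem _ _ (fderiv_chart_mem_span e hQ₀ hol U hU t htspan _)))
  -- hence `V = ⊤`
  intro ℓ _
  have hℓ : ℓ = ∑ i, ℓ (Pi.single i 1) • (ContinuousLinearMap.proj i : (Fin n → ℝ) →L[ℝ] ℝ) := by
    ext w
    have hw := dual_apply_eq_sum ℓ.toLinearMap w
    simp only [ContinuousLinearMap.coe_coe] at hw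
    rw [hw]
    simp [mul_comm]
  rw [hℓ]
  exact Submodule.sum_mem _ fun i _ => Submodule.smul_mem _ _ (hproj i)

/-- The space of continuous linear forms on `ℝⁿ` has dimension `n`. [folklore] -/
theorem finrank_dual_pi (n : ℕ) : Module.finrank ℝ ((Fin n → ℝ) →L[ℝ] ℝ) = n := by
  rw [← LinearEquiv.finrank_eq (LinearMap.toContinuousLinearMap :
      ((Fin n → ℝ) →ₗ[ℝ] ℝ) ≃ₗ[ℝ] (Fin n → ℝ) →L[ℝ] ℝ),
    Module.finrank_linearMap_self, Module.finrank_fin_fun]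

include hQ₀ hol in
/-- **`n` local coordinates have linearly independent differentials.** If `t₁, …, tₙ` (as many as
the dimension of the chart) span `𝔪` modulo `𝔪²` and `e` has regular coordinates, then
`dt₁, …, dtₙ` are linearly independent (they span the `n`-dimensional cotangent space,
`top_le_span_fderiv_chart`). [cite: SerreGAGA1956, §2 n°6 Cor. 2 with §1 n°4] -/
theorem linearIndependent_fderiv_chart (U : X.left.affineOpens) (hU : Q₀.pt ∈ (↑U : X.left.Opens))
    (t : Fin n → Γ(X.left, ↑U))
    (htspan : ∀ a ∈ RingHom.ker (Q₀.evalRingHom ↑U hU), ∃ coef : Fin n → ℝ,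
      a - ∑ i, SchemeOver.scalarRingHom X ↑U (coef i) * t i ∈
        RingHom.ker (Q₀.evalRingHom ↑U hU) ^ 2)
    (alg : ∃ (U₁ : X.left.affineOpens) (x : Fin n → Γ(X.left, ↑U₁)),
      e.source ⊆ {Q | Q.pt ∈ (↑U₁ : X.left.Opens)} ∧
        ∀ Q ∈ e.source, ∀ i, e Q i = evalOrZero ↑U₁ (x i) Q) :
    LinearIndependent ℝ fun i => fderiv ℝ (evalOrZero ↑U (t i) ∘ e.symm) (e Q₀) := by
  refine linearIndependent_of_top_le_span_of_card_eq_finrank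
    (top_le_span_fderiv_chart e hQ₀ hol U hU t htspan alg) ?_
  rw [Fintype.card_fin, finrank_dual_pi]

include hQ₀ hol in
/-- Under the hypotheses of `linearIndependent_fderiv_chart`, an element of `𝔪` with zero
differential at `e Q₀` lies in `𝔪²` (the kernel of `d` on `𝔪` is exactly `𝔪²`: **the embedding
dimension of `X(ℝ)` at `Q₀` is that of `𝒪_{X,Q₀}`**). [cite: SerreGAGA1956, §2 n°6 Cor. 2] -/
theorem mem_sq_of_fderiv_chart_eq_zero (U : X.left.affineOpens)
    (hU : Q₀.pt ∈ (↑U : X.left.Opens)) (t : Fin n → Γ(X.left, ↑U))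
    (htspan : ∀ a ∈ RingHom.ker (Q₀.evalRingHom ↑U hU), ∃ coef : Fin n → ℝ,
      a - ∑ i, SchemeOver.scalarRingHom X ↑U (coef i) * t i ∈
        RingHom.ker (Q₀.evalRingHom ↑U hU) ^ 2)
    (alg : ∃ (U₁ : X.left.affineOpens) (x : Fin n → Γ(X.left, ↑U₁)),
      e.source ⊆ {Q | Q.pt ∈ (↑U₁ : X.left.Opens)} ∧
        ∀ Q ∈ e.source, ∀ i, e Q i = evalOrZero ↑U₁ (x i) Q)
    {a : Γ(X.left, ↑U)} (ha : a ∈ RingHom.ker (Q₀.evalRingHom ↑U hU))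
    (hda : fderiv ℝ (evalOrZero ↑U a ∘ e.symm) (e Q₀) = 0) :
    a ∈ RingHom.ker (Q₀.evalRingHom ↑U hU) ^ 2 := by
  obtain ⟨coef, hcoef⟩ := htspan a ha
  have hli := linearIndependent_fderiv_chart e hQ₀ hol U hU t htspan alg
  have h0 := fderiv_chart_eq_zero_of_mem_sq e hQ₀ hol U hU hcoef
  have e1 : a - ∑ i, SchemeOver.scalarRingHom X ↑U (coef i) * t i +
      ∑ i, SchemeOver.scalarRingHom X ↑U (coef i) * t i = a := by ring
  have hsum : ∑ i, coef i • fderiv ℝ (evalOrZero ↑U (t i) ∘ e.symm) (e Q₀) = 0 := by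
    have h1 := congrArg (fun b => fderiv ℝ (evalOrZero ↑U b ∘ e.symm) (e Q₀)) e1
    rw [fderiv_chart_add e hQ₀ hol U hU, h0, zero_add, hda, fderiv_chart_sum e hQ₀ hol U hU] at h1
    simp only [fderiv_chart_smul e hQ₀ hol U hU] at h1
    exact h1
  have hc : ∀ i, coef i = 0 := Fintype.linearIndependent_iff.1 hli coef hsum
  simp only [hc, map_zero, zero_mul, Finset.sum_const_zero, sub_zero] at hcoef
  exact hcoef

end Chart

/-! ### Local coordinates modulo `𝔪²` at a real point of a smooth `ℝ`-scheme -/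

section LocalCoordinates

/-- **Local coordinates at a real point, inside a prescribed open set.** Let `X` be smooth of
relative dimension `n` over `ℝ`, `P ∈ X(ℝ)` and `W ∋ P` open. Then there are an affine open
`U ∋ P` with `U ⊆ W` and `t₁, …, tₙ ∈ 𝔪 = ker (evaluation at P) ⊆ Γ(X, U)` spanning `𝔪` modulo
`𝔪²` over `ℝ`: a standard smooth affine neighbourhood shrunk to a basic open inside `W`, whose
local ring at the `ℝ`-rational maximal ideal `𝔪` is regular of dimension `n` (Görtz–Wedhorn I
Lemma 6.26; the tree's `isRegularLocalRing_of_isStandardSmoothOfRelativeDimension`,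
`height_eq_of_isStandardSmoothOfRelativeDimension`, `GAGADimension.exists_sub_sum_smul_mem_sq`). The
real counterpart of the tree's complex `Motives.exists_localCoordinates_le`.
[cite: GortzWedhorn2020, Lemma 6.26] -/
theorem exists_localCoordinates_le (n : ℕ) [SmoothOfRelativeDimension n X.hom]
    (P : AlgPoints X ℝ) (W : X.left.Opens) (hPW : P.pt ∈ W) :
    ∃ (U : X.left.affineOpens) (hPU : P.pt ∈ (↑U : X.left.Opens)) (_ : (↑U : X.left.Opens) ≤ W)
      (t : Fin n → Γ(X.left, ↑U)),
      (∀ i, t i ∈ RingHom.ker (P.evalRingHom ↑U hPU)) ∧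
      ∀ a ∈ RingHom.ker (P.evalRingHom ↑U hPU), ∃ coef : Fin n → ℝ,
        a - ∑ i, SchemeOver.scalarRingHom X ↑U (coef i) * t i ∈
          RingHom.ker (P.evalRingHom ↑U hPU) ^ 2 := by
  classical
  obtain ⟨V, hV, hPV, hsm⟩ := AlgPoints.exists_isStandardSmoothOfRelativeDimension_scalarRingHom n P
  -- shrink to a basic open `D(h) ⊆ W`
  obtain ⟨h, hle, hPh⟩ := hV.exists_basicOpen_le ⟨P.pt, hPW⟩ hPV
  set U : X.left.Opens := X.left.basicOpen h with hUdef
  have hU : IsAffineOpen U := hV.basicOpen h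
  haveI : IsLocalization.Away h Γ(X.left, U) := hV.isLocalization_basicOpen h
  -- `Γ(X, D(h))` is standard smooth of relative dimension `n` over the scalars
  have h0 : (algebraMap Γ(X.left, V) Γ(X.left, U)).IsStandardSmoothOfRelativeDimension 0 :=
    RingHom.IsStandardSmoothOfRelativeDimension.algebraMap_isLocalizationAway h
  have hcomp : (algebraMap Γ(X.left, V) Γ(X.left, U)).comp (SchemeOver.scalarRingHom X V) =
      SchemeOver.scalarRingHom X U := by
    refine RingHom.ext fun c => ?_
    rw [RingHom.comp_apply, SchemeOver.scalarRingHom_apply, SchemeOver.scalarRingHom_apply]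
    change (X.hom.appLE ⊤ V le_top ≫ X.left.presheaf.map (homOfLE (X.left.basicOpen_le h)).op) _ = _
    rw [Scheme.Hom.appLE_map]
  have hsmU : (SchemeOver.scalarRingHom X U).IsStandardSmoothOfRelativeDimension n := by
    have := RingHom.IsStandardSmoothOfRelativeDimension.comp h0 hsm
    rw [hcomp, Nat.zero_add] at this
    exact this
  letI : Algebra ℝ Γ(X.left, U) := (SchemeOver.scalarRingHom X U).toAlgebra
  haveI : Algebra.IsStandardSmoothOfRelativeDimension n ℝ Γ(X.left, U) := hsmU
  haveI : Algebra.IsStandardSmooth ℝ Γ(X.left, U) :=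
    Algebra.IsStandardSmoothOfRelativeDimension.isStandardSmooth n
  haveI : Algebra.FiniteType ℝ Γ(X.left, U) := inferInstance
  haveI : IsNoetherianRing Γ(X.left, U) := Algebra.FiniteType.isNoetherianRing ℝ _
  have hPU : P.pt ∈ U := hPh
  -- the `ℝ`-rational maximal ideal of `P`
  set 𝔪 := RingHom.ker (P.evalRingHom U hPU) with h𝔪
  haveI h𝔪max : 𝔪.IsMaximal := isMaximal_ker_evalRingHom P hPU
  haveI := Literature.AlgebraicGeometry.Motives.isRegularLocalRing_of_isStandardSmoothOfRelativeDimension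
    ℝ n 𝔪
  have hdim : ringKrullDim (Localization.AtPrime 𝔪) = n := by
    rw [IsLocalization.AtPrime.ringKrullDim_eq_height 𝔪,
      Literature.AlgebraicGeometry.Motives.height_eq_of_isStandardSmoothOfRelativeDimension ℝ n 𝔪]
    rfl
  let ψ : Γ(X.left, U) →ₐ[ℝ] ℝ :=
    { P.evalRingHom U hPU with commutes' := fun c => AlgPoints.eval_scalarRingHom P hPU c }
  have hψ : ∀ a, ψ a = 0 ↔ a ∈ 𝔪 := fun a => by rw [h𝔪, RingHom.mem_ker]; rfl
  obtain ⟨t, ht𝔪, htspan⟩ :=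
    Literature.AlgebraicGeometry.HodgeTheory.GAGADimension.exists_sub_sum_smul_mem_sq ℝ 𝔪 hdim ψ hψ
  refine ⟨⟨U, hU⟩, hPU, hle, t, ht𝔪, fun a ha => ?_⟩
  obtain ⟨coef, hcoef⟩ := htspan a ha
  refine ⟨coef, ?_⟩
  simp only [Algebra.smul_def] at hcoef
  exact hcoef

end LocalCoordinates

/-! ### Local coordinates are analytic coordinates: centred charts of the maximal atlas -/

section CentredChart

/-- Post-composing a chart of the maximal atlas with an element of the structure groupoid (a
`C^n` local diffeomorphism of the model space) gives a chart of the maximal atlas. [folklore] -/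
theorem trans_mem_maximalAtlas_of_mem_groupoid {H M : Type*} [TopologicalSpace H]
    [TopologicalSpace M] [ChartedSpace H M] (G : StructureGroupoid H)
    {e : OpenPartialHomeomorph M H} (he : e ∈ G.maximalAtlas M)
    {h : OpenPartialHomeomorph H H} (hh : h ∈ G) : e.trans h ∈ G.maximalAtlas M := by
  rw [mem_maximalAtlas_iff]
  intro e' he'
  obtain ⟨h1, h2⟩ := mem_maximalAtlas_iff.1 he e' he'
  refine ⟨?_, ?_⟩
  · rw [OpenPartialHomeomorph.trans_symm_eq_symm_trans_symm, OpenPartialHomeomorph.trans_assoc]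
    exact G.trans (G.symm hh) h1
  · rw [← OpenPartialHomeomorph.trans_assoc]
    exact G.trans h2 hh

/-- An open partial homeomorphism of `ℝⁿ` which is real-analytic on its source, with inverse
real-analytic on its target, belongs to the `C^ω` groupoid of the model space `ℝⁿ`. [folklore] -/
theorem mem_contDiffGroupoid_of_analyticOnNhd {h : OpenPartialHomeomorph (Fin n → ℝ) (Fin n → ℝ)}
    (h1 : AnalyticOnNhd ℝ h h.source) (h2 : AnalyticOnNhd ℝ h.symm h.target) :
    h ∈ contDiffGroupoid ω 𝓘(ℝ, Fin n → ℝ) := by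
  rw [contDiffGroupoid, mem_groupoid_of_pregroupoid]
  simp only [contDiffPregroupoid, modelWithCornersSelf_coe, modelWithCornersSelf_coe_symm,
    CompTriple.comp_eq, Set.range_id, Set.preimage_id_eq, id_eq, Set.inter_univ]
  exact ⟨h1.contDiffOn_of_completeSpace, h2.contDiffOn_of_completeSpace⟩

/-- **Local coordinates are analytic coordinates (centred charts).** Let `X(ℝ)` carry the
real-analytic manifold structure of `RealPointsManifold.exists_chartedSpace_isManifold` (charts
`chart P` with regular coordinates `alg`, regular functions analytic `hol`), let `U ∋ Q₀` be affine
and let `t₁, …, tₙ ∈ 𝔪 = ker (evaluation at Q₀) ⊆ Γ(X, U)` span `𝔪` modulo `𝔪²` over `ℝ`. Then for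
every open `O ∋ Q₀` there is a chart `φ` of the maximal `C^ω` atlas of `X(ℝ)` with
`Q₀ ∈ φ.source ⊆ O ∩ U(ℝ)`, `φ(Q₀) = 0`, `φ(Q) = (t₁(Q), …, tₙ(Q))` on `φ.source`, in which every
regular function on every affine open is real-analytic. Proof: in the chart `e = chart Q₀` the map
`T = (tᵢ ∘ e⁻¹)ᵢ` is analytic with invertible differential at `e Q₀` (its rows `dtᵢ` are linearly
independent, `linearIndependent_fderiv_chart`), so the inverse function theorem (Mathlib
`ContDiffAt.toOpenPartialHomeomorph`, smoothness `ω`) makes `T` an analytic local diffeomorphism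
of `ℝⁿ`, i.e. an element of the `C^ω` groupoid, and `φ = T ∘ e`. (Serre, GAGA §2 n°6 Cor. 2: a
regular system of parameters at a simple point is a system of local analytic coordinates;
Bochnak–Coste–Roy Prop. 3.3.11 for real points.) [cite: SerreGAGA1956, §2 n°6 Cor. 2]
[cite: BochnakCosteRoy1998, Prop. 3.3.11] -/
theorem exists_centredChart
    (chart : AlgPoints X ℝ → OpenPartialHomeomorph (AlgPoints X ℝ) (Fin n → ℝ))
    [cs : ChartedSpace (Fin n → ℝ) (AlgPoints X ℝ)] [IsManifold 𝓘(ℝ, Fin n → ℝ) ω (AlgPoints X ℝ)]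
    (hchart : ∀ P, chartAt (Fin n → ℝ) P = chart P) (mem : ∀ P, P ∈ (chart P).source)
    (alg : ∀ P, ∃ (U₁ : X.left.affineOpens) (x : Fin n → Γ(X.left, ↑U₁)),
      (chart P).source ⊆ {Q | Q.pt ∈ (↑U₁ : X.left.Opens)} ∧
        ∀ Q ∈ (chart P).source, ∀ i, chart P Q i = evalOrZero ↑U₁ (x i) Q)
    (hol : ∀ P (U : X.left.affineOpens) (s : Γ(X.left, ↑U)),
      AnalyticOnNhd ℝ (evalOrZero ↑U s ∘ (chart P).symm)
        ((chart P).target ∩ (chart P).symm ⁻¹' {Q | Q.pt ∈ (↑U : X.left.Opens)}))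
    (U : X.left.affineOpens) {Q₀ : AlgPoints X ℝ} (hU : Q₀.pt ∈ (↑U : X.left.Opens))
    (t : Fin n → Γ(X.left, ↑U)) (ht0 : ∀ i, t i ∈ RingHom.ker (Q₀.evalRingHom ↑U hU))
    (htspan : ∀ a ∈ RingHom.ker (Q₀.evalRingHom ↑U hU), ∃ coef : Fin n → ℝ,
      a - ∑ i, SchemeOver.scalarRingHom X ↑U (coef i) * t i ∈
        RingHom.ker (Q₀.evalRingHom ↑U hU) ^ 2)
    {O : Set (AlgPoints X ℝ)} (hO : IsOpen O) (hQ₀O : Q₀ ∈ O) :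
    ∃ φ : OpenPartialHomeomorph (AlgPoints X ℝ) (Fin n → ℝ),
      φ ∈ IsManifold.maximalAtlas 𝓘(ℝ, Fin n → ℝ) ω (AlgPoints X ℝ) ∧
      Q₀ ∈ φ.source ∧ φ Q₀ = 0 ∧ φ.source ⊆ O ∩ {Q | Q.pt ∈ (↑U : X.left.Opens)} ∧
      (∀ Q ∈ φ.source, ∀ i, φ Q i = evalOrZero ↑U (t i) Q) ∧
      ∀ (U' : X.left.affineOpens) (s : Γ(X.left, ↑U')),
        AnalyticOnNhd ℝ (evalOrZero ↑U' s ∘ φ.symm)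
          (φ.target ∩ φ.symm ⁻¹' {Q | Q.pt ∈ (↑U' : X.left.Opens)}) := by
  classical
  set e := chart Q₀ with he
  have hQ₀ : Q₀ ∈ e.source := mem Q₀
  have hol' := hol Q₀
  have alg' := alg Q₀
  -- the coordinate map `T = (tᵢ ∘ e⁻¹)ᵢ` and its differential at `e Q₀`
  set T : (Fin n → ℝ) → (Fin n → ℝ) := fun w i => evalOrZero ↑U (t i) (e.symm w) with hT
  have hTan : ∀ w ∈ e.target ∩ e.symm ⁻¹' {Q : AlgPoints X ℝ | Q.pt ∈ (↑U : X.left.Opens)},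
      AnalyticAt ℝ T w := fun w hw =>
    AnalyticAt.pi fun i => hol' U (t i) w hw
  have hw₀ : e Q₀ ∈ e.target ∩ e.symm ⁻¹' {Q : AlgPoints X ℝ | Q.pt ∈ (↑U : X.left.Opens)} :=
    ⟨e.map_source hQ₀, by
      simp only [Set.mem_preimage, Set.mem_setOf_eq, e.left_inv hQ₀]; exact hU⟩
  have hTan₀ : AnalyticAt ℝ T (e Q₀) := hTan _ hw₀
  set L : Fin n → (Fin n → ℝ) →L[ℝ] ℝ := fun i => fderiv ℝ (evalOrZero ↑U (t i) ∘ e.symm) (e Q₀)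
    with hL
  have hspan : ⊤ ≤ Submodule.span ℝ (Set.range L) :=
    top_le_span_fderiv_chart e hQ₀ hol' U hU t htspan alg'
  set T'lin : (Fin n → ℝ) →L[ℝ] (Fin n → ℝ) := ContinuousLinearMap.pi L with hT'lin
  have hTderiv : HasFDerivAt T T'lin (e Q₀) := by
    rw [hT'lin, hasFDerivAt_pi]
    intro i
    exact (differentiableAt_chart e hQ₀ hol' U hU (t i)).hasFDerivAt
  have hker : ∀ v, T'lin v = 0 → v = 0 := by
    intro v hv
    have hv' : ∀ i, L i v = 0 := fun i => by
      have := congrFun hv i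
      simpa [hT'lin] using this
    have hall : ∀ ℓ ∈ Submodule.span ℝ (Set.range L), (ℓ : (Fin n → ℝ) →L[ℝ] ℝ) v = 0 := by
      intro ℓ hℓ
      refine Submodule.span_induction (p := fun ℓ _ => (ℓ : (Fin n → ℝ) →L[ℝ] ℝ) v = 0)
        ?_ ?_ ?_ ?_ hℓ
      · rintro _ ⟨i, rfl⟩; exact hv' i
      · simp
      · intro x y _ _ hx hy; simp [hx, hy]
      · intro c x _ hx; simp [hx]
    funext j
    have := hall (ContinuousLinearMap.proj j) (hspan Submodule.mem_top)
    simpa using this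
  have hinj : Function.Injective (T'lin : (Fin n → ℝ) →ₗ[ℝ] (Fin n → ℝ)) :=
    (injective_iff_map_eq_zero _).2 fun v hv => hker v (by simpa using hv)
  set T' : (Fin n → ℝ) ≃L[ℝ] (Fin n → ℝ) :=
    (LinearEquiv.ofInjectiveEndo (T'lin : (Fin n → ℝ) →ₗ[ℝ] (Fin n → ℝ)) hinj).toContinuousLinearEquiv
    with hT'
  have hT'coe : (T' : (Fin n → ℝ) →L[ℝ] (Fin n → ℝ)) = T'lin := by
    ext v i
    rfl
  have hTderiv' : HasFDerivAt T (T' : (Fin n → ℝ) →L[ℝ] (Fin n → ℝ)) (e Q₀) := by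
    rw [hT'coe]; exact hTderiv
  -- the inverse function theorem in smoothness `ω`
  have hTcd : ContDiffAt ℝ ω T (e Q₀) := hTan₀.contDiffAt
  have hω : (ω : WithTop ℕ∞) ≠ 0 := by simp
  set Th := hTcd.toOpenPartialHomeomorph T hTderiv' hω with hTh
  have hThcoe : (Th : (Fin n → ℝ) → (Fin n → ℝ)) = T := ContDiffAt.toOpenPartialHomeomorph_coe _ _ _
  have hThsrc : e Q₀ ∈ Th.source := hTcd.mem_toOpenPartialHomeomorph_source hTderiv' hω
  have hThsymm : AnalyticAt ℝ Th.symm (T (e Q₀)) :=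
    (hTcd.to_localInverse hTderiv' hω).analyticAt
  -- analytic restriction of `Th`
  set S₀ : Set (Fin n → ℝ) := e.target ∩ e.symm ⁻¹' {Q : AlgPoints X ℝ | Q.pt ∈ (↑U : X.left.Opens)}
    with hS₀
  have hS₀open : IsOpen S₀ := e.isOpen_inter_preimage_symm (AlgPoints.isOpen_setOf_pt_mem _)
  set S₁ : Set (Fin n → ℝ) := {z | AnalyticAt ℝ Th.symm z} with hS₁
  have hS₁open : IsOpen S₁ := isOpen_analyticAt ℝ Th.symm
  set s : Set (Fin n → ℝ) := S₀ ∩ T ⁻¹' S₁ with hs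
  have hsopen : IsOpen s :=
    (ContinuousOn.isOpen_inter_preimage (fun w hw => (hTan w hw).continuousAt.continuousWithinAt)
      hS₀open hS₁open)
  have hws : e Q₀ ∈ s := ⟨hw₀, hThsymm⟩
  set Th' := Th.restrOpen s hsopen with hTh'
  have hTh'G : Th' ∈ contDiffGroupoid ω 𝓘(ℝ, Fin n → ℝ) := by
    refine mem_contDiffGroupoid_of_analyticOnNhd ?_ ?_
    · intro w hw
      rw [hTh', OpenPartialHomeomorph.restrOpen_source] at hw
      rw [hTh', OpenPartialHomeomorph.coe_restrOpen, hThcoe]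
      exact hTan w hw.2.1
    · intro z hz
      rw [hTh', OpenPartialHomeomorph.coe_restrOpen_symm]
      have hz' : z ∈ Th.target ∧ Th.symm z ∈ s := by
        rw [hTh'] at hz
        exact ⟨hz.1, hz.2⟩
      have : T (Th.symm z) = z := by rw [← hThcoe]; exact Th.right_inv hz'.1
      have hzS₁ : z ∈ S₁ := by rw [← this]; exact hz'.2.2
      exact hzS₁
  -- the chart
  have heatlas : e ∈ atlas (Fin n → ℝ) (AlgPoints X ℝ) := by
    rw [he, ← hchart Q₀]; exact chart_mem_atlas _ Q₀
  have hemax : e ∈ IsManifold.maximalAtlas 𝓘(ℝ, Fin n → ℝ) ω (AlgPoints X ℝ) :=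
    IsManifold.subset_maximalAtlas heatlas
  set φ₀ := e.trans Th' with hφ₀
  have hφ₀max : φ₀ ∈ IsManifold.maximalAtlas 𝓘(ℝ, Fin n → ℝ) ω (AlgPoints X ℝ) :=
    trans_mem_maximalAtlas_of_mem_groupoid _ hemax hTh'G
  set O' : Set (AlgPoints X ℝ) := O ∩ {Q | Q.pt ∈ (↑U : X.left.Opens)} with hO'
  have hO'open : IsOpen O' := hO.inter (AlgPoints.isOpen_setOf_pt_mem _)
  set φ := φ₀.restr O' with hφ
  have hφmax : φ ∈ IsManifold.maximalAtlas 𝓘(ℝ, Fin n → ℝ) ω (AlgPoints X ℝ) :=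
    restr_mem_maximalAtlas _ hφ₀max hO'open
  have hφsrc : φ.source = (e.source ∩ e ⁻¹' Th'.source) ∩ O' := by
    rw [hφ, OpenPartialHomeomorph.restr_source' _ _ hO'open, hφ₀, OpenPartialHomeomorph.trans_source]
  have hφcoe : ∀ Q, φ Q = T (e Q) := fun Q => by
    rw [hφ, hφ₀]
    simp only [OpenPartialHomeomorph.restr_apply, OpenPartialHomeomorph.coe_trans,
      Function.comp_apply, hTh', OpenPartialHomeomorph.coe_restrOpen, hThcoe]
  have hφsymm : ∀ z, φ.symm z = e.symm (Th.symm z) := fun z => by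
    rw [hφ, hφ₀]
    simp only [OpenPartialHomeomorph.restr_symm_apply, OpenPartialHomeomorph.coe_trans_symm,
      Function.comp_apply, hTh', OpenPartialHomeomorph.coe_restrOpen_symm]
  refine ⟨φ, hφmax, ?_, ?_, ?_, ?_, ?_⟩
  · rw [hφsrc]
    refine ⟨⟨hQ₀, ?_⟩, hQ₀O, hU⟩
    show e Q₀ ∈ Th'.source
    rw [hTh', OpenPartialHomeomorph.restrOpen_source]
    exact ⟨hThsrc, hws⟩
  · rw [hφcoe]
    funext i
    simp only [hT, e.left_inv hQ₀, evalOrZero_of_mem _ hU, Pi.zero_apply]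
    have := ht0 i
    rwa [RingHom.mem_ker, AlgPoints.evalRingHom_apply] at this
  · rw [hφsrc]; exact Set.inter_subset_right
  · intro Q hQ i
    rw [hφsrc] at hQ
    rw [hφcoe]
    simp only [hT, e.left_inv hQ.1.1]
  · intro U' s' z hz
    have hz1 : z ∈ φ.target := hz.1
    have hz2 : (φ.symm z).pt ∈ (↑U' : X.left.Opens) := hz.2
    rw [hφsymm] at hz2
    have hφt : φ.target ⊆ Th'.target ∩ Th'.symm ⁻¹' e.target := by
      rw [hφ, hφ₀]
      intro y hy
      rw [OpenPartialHomeomorph.restr_target] at hy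
      have hy' := hy.1
      rw [OpenPartialHomeomorph.trans_target] at hy'
      exact hy'
    have hzt := hφt hz1
    have hzTh : z ∈ Th.target ∧ Th.symm z ∈ s := by
      have := hzt.1
      rw [hTh'] at this
      exact ⟨this.1, this.2⟩
    have hze : Th.symm z ∈ e.target := by
      have := hzt.2
      rwa [Set.mem_preimage, hTh', OpenPartialHomeomorph.coe_restrOpen_symm] at this
    have hTz : T (Th.symm z) = z := by rw [← hThcoe]; exact Th.right_inv hzTh.1
    have hzS₁ : AnalyticAt ℝ Th.symm z := by
      have h' := hzTh.2.2
      rw [Set.mem_preimage, hTz] at h'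
      exact h'
    have hcomp : evalOrZero ↑U' s' ∘ φ.symm = (evalOrZero ↑U' s' ∘ e.symm) ∘ Th.symm := by
      funext y; simp only [Function.comp_apply, hφsymm]
    rw [hcomp]
    exact (hol' U' s' (Th.symm z) ⟨hze, hz2⟩).comp hzS₁

end CentredChart

end RealPoints

end Literature.AlgebraicGeometry.RealAlgebraic

end
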